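import Summits.CriticalPhenomena.SAWScalingLimit.Theorems.SAWDevelopingMapObservableToSLECanonicalTransferLatticeChains
import Summits.CriticalPhenomena.SAWScalingLimit.Theorems.SAWDevelopingMapObservableToSLECanonicalTransferCompactCore
import HarnessLib

/-!
# Crux `SAWDevelopingMap.ObservableToSLE` (stmt-CriticalPhenomena-10472), line
`floor-ratio-restriction-bootstrap`, stub `stub_canonicalTransfer`: exhaustion of compacts by deep
lattice walks (inner admissible discretisation (M1))

Landing target:
`Summits/CriticalPhenomena/SAWScalingLimit/Theorems/SAWDevelopingMapObservableToSLECanonicalTransferExhaustion.lean`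
(`--supports stmt-CriticalPhenomena-10472`).  Sequel of `…CanonicalTransferLatticeChains.lean` and
`…CanonicalTransferCompactCore.lean`.

* `exists_walk_deep_of_isCompact` = registered sub-goal `stub_canonicalTransfer_exhaustion` — for an
  open connected `U ⊆ ℂ`, a compact `K ⊆ U` and `x₀ ∈ U` there is `ε > 0` such that at every mesh
  `δ` and depth `r` with `0 < δ`, `4δ + r ≤ ε`, every lattice vertex `v` with `δ c_v ∈ K` is joined
  to every lattice vertex `v₀` within `δ` of `x₀` by a honeycomb walk all of whose vertices `u` are
  `r`-deep in `U` (`closedBall (δ c_u) r ⊆ U`).  With `r = 3√δ` this puts the lattice points of `K`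
  into the main component of the deep vertices, i.e. into the inner admissible family of (M1), for
  all small `δ` ("exhaustion of the compacts").
-/

noncomputable section

open scoped Topology
open Filter Set Metric
open Literature.Probability.LatticeModels (HexVertex hexGraph hexCenter)
open Literature.Probability.RandomPlanarGeometry
open Literature.Probability.RandomPlanarGeometry.SAW

namespace Summit.CriticalPhenomena.SAWScalingLimit.Theorems.ObservableToSLE.FloorRatio

/-- **Exhaustion of compacts by deep lattice walks** (named form of the registered sub-goal
`stub_canonicalTransfer_exhaustion`): see the module docstring.  (Compact connected core `S ⊇ K`
with `cthickening ε S ⊆ U`; lattice walk along `S` within `4δ` of it; a vertex within `4δ` of `S`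
is `r`-deep as soon as `4δ + r ≤ ε`.) [folklore] -/
theorem exists_walk_deep_of_isCompact {U K : Set ℂ} (hU : IsOpen U) (hUc : IsConnected U)
    (hK : IsCompact K) (hKU : K ⊆ U) {x₀ : ℂ} (hx₀ : x₀ ∈ U) :
    ∃ ε > 0, ∀ (δ r : ℝ), 0 < δ → 4 * δ + r ≤ ε → ∀ v₀ v : HexVertex,
      dist ((δ : ℂ) * hexCenter v₀) x₀ ≤ δ → (δ : ℂ) * hexCenter v ∈ K →
      ∃ p : hexGraph.Walk v₀ v, ∀ u ∈ p.support, closedBall ((δ : ℂ) * hexCenter u) r ⊆ U := by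
  obtain ⟨S, ε, hε, hKS, hx₀S, hSc, hSconn, hεU⟩ :=
    exists_compact_connected_core_cthickening hU hUc hK hKU hx₀
  refine ⟨ε, hε, fun δ r hδ hle v₀ v hv₀ hv => ?_⟩
  obtain ⟨p, hp⟩ := exists_walk_near_of_isPreconnected hSconn.isPreconnected hδ le_rfl hx₀S
    (hKS hv) hv₀ (w := v) (by rw [dist_self]; exact hδ.le)
  refine ⟨p, fun u hu z hz => hεU ?_⟩
  obtain ⟨y, hyS, hdy⟩ := hp u hu
  refine mem_cthickening_of_dist_le z y ε S hyS ?_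
  rw [mem_closedBall] at hz
  calc dist z y ≤ dist z ((δ : ℂ) * hexCenter u) + dist ((δ : ℂ) * hexCenter u) y :=
        dist_triangle _ _ _
    _ ≤ r + 4 * δ := add_le_add hz hdy.le
    _ ≤ ε := by linarith

/-- **Registered sub-goal `stub_canonicalTransfer_exhaustion`** (crux item stmt-CriticalPhenomena-10472,
line `floor-ratio-restriction-bootstrap`, stub `stub_canonicalTransfer`): exhaustion of compacts by
deep lattice walks, registry form of `exists_walk_deep_of_isCompact`. [folklore] -/
theorem stub_canonicalTransfer_exhaustion :
    ∀ (U K : Set ℂ) (x₀ : ℂ), IsOpen U → IsConnected U → IsCompact K → K ⊆ U → x₀ ∈ U →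
    ∃ ε > 0, ∀ (δ r : ℝ), 0 < δ → 4 * δ + r ≤ ε → ∀ v₀ v : HexVertex,
      dist ((δ : ℂ) * hexCenter v₀) x₀ ≤ δ → (δ : ℂ) * hexCenter v ∈ K →
      ∃ p : hexGraph.Walk v₀ v, ∀ u ∈ p.support, closedBall ((δ : ℂ) * hexCenter u) r ⊆ U :=
  fun _ _ _ hU hUc hK hKU hx₀ => exists_walk_deep_of_isCompact hU hUc hK hKU hx₀

end Summit.CriticalPhenomena.SAWScalingLimit.Theorems.ObservableToSLE.FloorRatio

end
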